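import Summits.ResolutionOfSingularities.ResolutionOfSingularities.Theorems.FrobeniusLadderFInjectiveMacaulayficationPointFixableCentre
import HarnessLib

/-!
# The fibre ideal of a base point on an affine chart upstairs (`FibreIdealOfBasePoint`, E7 N4b)

[OURS · L1 W4.5a] Support file for crux stmt-ResolutionOfSingularities-15315
(`FrobeniusLadder.FInjectiveMacaulayfication`), E7 two-level tower format (memo `E7-SCOPING.md` of res-L1-w45a-lead-1,
§2 N4; res-L1-w45a-lead-1 OFFER 10:23:26Z «N4b»). It DISCHARGES the two bookkeeping binders `h𝔟` / `hcover` of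
`TwoLevelTower.twoLevelTower_good` for the instance layer:

* For a morphism `π₁ : X' ⟶ X`, a point `b ∈ V` of an affine open `V` of `X`, and an affine open `U` of `X'` with
  `U ≤ π₁⁻¹ V`, the FIBRE IDEAL of `b` on `U` is `𝔟_U := 𝔭_b · Γ(X', U)`, the extension of the prime `𝔭_b ⊆ Γ(X, V)` of `b`
  along `π₁.appLE V U : Γ(X, V) ⟶ Γ(X', U)` (no definition is declared; the expression is spelled out in each statement).
  `map_primeIdealOf_le` (= `h𝔟`): a point `z` of the chart `Spec Γ(X', U)` lying over `b` has `𝔟_U ≤ z`; with `b` closed the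
  converse holds too (`map_primeIdealOf_le_iff`). Mechanism: Mathlib's `IsAffineOpen.comap_primeIdealOf_appLE`
  (`𝔭_{x'} ∩ Γ(X, V) = 𝔭_{π₁ x'}`) and, for the converse, `𝔭_b ≤ 𝔭_{π₁ x'} ⇒ b ⤳ π₁ x'` plus closedness of `b`
  (pattern `PointFixableCentre.under_le_primeIdealOf_iff`).
* `exists_mem_of_preimage_le_iSup` (= `hcover`): if finitely many opens `U σ` cover `π₁⁻¹ V`, every point over `b` lies in
  some `U σ`.

References: folklore bookkeeping over Mathlib's `AlgebraicGeometry.AffineScheme` API (`IsAffineOpen.primeIdealOf`,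
`fromSpec`); no statement of Hironaka 2017 is used; no definition, no named fact; AI-written (AI review is weaker than
expert review). [folklore]
-/

-- single-problem summit: the doubled namespace component `ResolutionOfSingularities` is forced
set_option linter.dupNamespace false

noncomputable section

namespace Summit.ResolutionOfSingularities.ResolutionOfSingularities.Theorems.FInjectiveMacaulayfication.FibreIdealOfBasePoint

open AlgebraicGeometry CategoryTheory TopologicalSpace
open Summit.ResolutionOfSingularities.ResolutionOfSingularities.Theorems.FInjectiveMacaulayfication

/-- **The contraction of a chart point over `V` is the prime of its image.** For `π₁ : X' ⟶ X`, affine opens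
`U ≤ π₁⁻¹ V`, and a point `z` of `Spec Γ(X', U)`, the contraction of `z` along `π₁.appLE V U` is the prime of `Γ(X, V)`
corresponding to the image point `π₁ (fromSpec z) ∈ V`. [folklore] -/
theorem comap_appLE_asIdeal_eq {X X' : Scheme.{0}} (π₁ : X' ⟶ X) (V : X.affineOpens) (U : X'.affineOpens)
    (hUV : (U : X'.Opens) ≤ π₁ ⁻¹ᵁ (V : X.Opens)) (z : ↥(Spec Γ(X', U))) :
    z.asIdeal.comap (π₁.appLE V U hUV).hom =
      (V.2.primeIdealOf ⟨π₁.base (U.2.fromSpec.base z),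
        hUV (PointCentreIdealSheaf.fromSpec_mem U.2 z)⟩).asIdeal := by
  have hz : U.2.primeIdealOf ⟨U.2.fromSpec.base z, PointCentreIdealSheaf.fromSpec_mem U.2 z⟩ = z :=
    PointCentreIdealSheaf.primeIdealOf_fromSpec U.2 z _
  have key := IsAffineOpen.comap_primeIdealOf_appLE (f := π₁) (V : X.Opens) V.2 (U : X'.Opens) U.2 hUV
    (PointCentreIdealSheaf.fromSpec_mem U.2 z)
  rw [hz] at key
  rw [← key]
  rfl

/-- **`h𝔟` — a chart point over `b` contains the fibre ideal `𝔟_U = 𝔭_b · Γ(X', U)`.** For `π₁ : X' ⟶ X`, `b ∈ V`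
(`V` an affine open of `X`), `U ≤ π₁⁻¹ V` an affine open of `X'`, and `z : Spec Γ(X', U)` with
`π₁ (fromSpec z) = b`: `𝔭_b · Γ(X', U) ≤ z`. [folklore] -/
theorem map_primeIdealOf_le {X X' : Scheme.{0}} (π₁ : X' ⟶ X) (b : X) (V : X.affineOpens) (hb : b ∈ (V : X.Opens))
    (U : X'.affineOpens) (hUV : (U : X'.Opens) ≤ π₁ ⁻¹ᵁ (V : X.Opens)) (z : ↥(Spec Γ(X', U)))
    (hz : π₁.base (U.2.fromSpec.base z) = b) :
    ((V.2.primeIdealOf ⟨b, hb⟩).asIdeal).map (π₁.appLE V U hUV).hom ≤ z.asIdeal := by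
  rw [Ideal.map_le_iff_le_comap, comap_appLE_asIdeal_eq π₁ V U hUV z]
  have hpt : (⟨π₁.base (U.2.fromSpec.base z), hUV (PointCentreIdealSheaf.fromSpec_mem U.2 z)⟩ : (V : X.Opens)) =
      ⟨b, hb⟩ := Subtype.ext hz
  rw [hpt]

/-- **`h𝔟` as an equivalence, for a closed base point.** With `b` a closed point of `X`, a chart point `z` of
`Spec Γ(X', U)` lies over `b` iff `𝔭_b · Γ(X', U) ≤ z` (the backward direction: `𝔭_b ≤ 𝔭_{π₁ x'}` means `b ⤳ π₁ x'`,
and `b` is closed). [folklore] -/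
theorem map_primeIdealOf_le_iff {X X' : Scheme.{0}} (π₁ : X' ⟶ X) (b : X) (hbcl : IsClosed ({b} : Set X))
    (V : X.affineOpens) (hb : b ∈ (V : X.Opens)) (U : X'.affineOpens) (hUV : (U : X'.Opens) ≤ π₁ ⁻¹ᵁ (V : X.Opens))
    (z : ↥(Spec Γ(X', U))) :
    ((V.2.primeIdealOf ⟨b, hb⟩).asIdeal).map (π₁.appLE V U hUV).hom ≤ z.asIdeal ↔
      π₁.base (U.2.fromSpec.base z) = b := by
  refine ⟨fun hle => ?_, map_primeIdealOf_le π₁ b V hb U hUV z⟩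
  set x := π₁.base (U.2.fromSpec.base z) with hx
  have hxV : x ∈ (V : X.Opens) := hUV (PointCentreIdealSheaf.fromSpec_mem U.2 z)
  -- `𝔭_b ≤ 𝔭_x` in `Spec Γ(X, V)`
  have hbx : (V.2.primeIdealOf ⟨b, hb⟩).asIdeal ≤ (V.2.primeIdealOf ⟨x, hxV⟩).asIdeal := by
    rw [Ideal.map_le_iff_le_comap, comap_appLE_asIdeal_eq π₁ V U hUV z] at hle
    exact hle
  -- hence `b ⤳ x`, and `b` is closed
  have hspec : (V.2.primeIdealOf ⟨b, hb⟩) ⤳ (V.2.primeIdealOf ⟨x, hxV⟩) :=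
    (PrimeSpectrum.le_iff_specializes _ _).mp hbx
  have hspec' : b ⤳ x := by
    have h := hspec.map V.2.fromSpec.base.hom.continuous
    rwa [show V.2.fromSpec.base.hom (V.2.primeIdealOf ⟨b, hb⟩) = b from V.2.fromSpec_primeIdealOf ⟨b, hb⟩,
      show V.2.fromSpec.base.hom (V.2.primeIdealOf ⟨x, hxV⟩) = x from V.2.fromSpec_primeIdealOf ⟨x, hxV⟩] at h
  have hmem : x ∈ closure ({b} : Set X) := specializes_iff_mem_closure.mp hspec'
  rw [hbcl.closure_eq] at hmem
  exact hmem

/-- **`hcover` — points over `b` lie in one of the charts covering `π₁⁻¹ V`.** If `b ∈ V` and the opens `U σ`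
(`σ : Fin N`) cover `π₁⁻¹ V`, every point `x'` of `X'` with `π₁ x' = b` lies in some `U σ`. [folklore] -/
theorem exists_mem_of_preimage_le_iSup {X X' : Scheme.{0}} (π₁ : X' ⟶ X) (b : X) (V : X.Opens) (hb : b ∈ V)
    (N : ℕ) (U : Fin N → X'.affineOpens) (hcov : π₁ ⁻¹ᵁ V ≤ ⨆ σ : Fin N, (U σ : X'.Opens)) :
    ∀ x' : X', π₁.base x' = b → ∃ σ : Fin N, x' ∈ (U σ : X'.Opens) := by
  intro x' hx'
  have hxV : x' ∈ π₁ ⁻¹ᵁ V := by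
    show π₁.base x' ∈ V
    rw [hx']
    exact hb
  exact Opens.mem_iSup.mp (hcov hxV)

end Summit.ResolutionOfSingularities.ResolutionOfSingularities.Theorems.FInjectiveMacaulayfication.FibreIdealOfBasePoint

end
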